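import Summits.QuantumAdvantage.QuantumAdvantage.Theorems.SaturationCriterionA
import Summits.QuantumAdvantage.QuantumAdvantage.Theorems.BilinearCubeSumA

set_option linter.dupNamespace false
set_option linter.unusedSectionVars false

/-!
# QuadSaturationA (lens 4, g29; kernel step K5 of the (c0) road ASSEMBLED) — A LABELLED QUADRATIC MAP ON A PRODUCT OF TWO CUBES IS ONTO WHEN ITS LINEAR PART IS FREE AND ITS CROSS BLOCK DISPERSES

Blocker `X = AbsorptionDial.NoPerfectPolyOdd` (item 28487); decomp-qadv lens 4, g29.  This is (P4) of REFEREE-66v65 as ONE theorem, on top of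
`SaturationCriterionA` (counting formula / non-empty-fibre criterion / weighted linear cube sums) and `BilinearCubeSumA` (Cauchy–Schwarz along a
bipartition).  The column pool is given ALREADY SPLIT along the bipartition, `x = (x₁, x₂) ∈ {0,1}^{ι₁} × {0,1}^{ι₂}`; the map has

* `K` LINEAR coordinates `lin_j(x) = Σ_{x₁ i} L₁ j i + Σ_{x₂ i} L₂ j i` (cross terms with the cut rows, labels),
* ONE QUADRATIC coordinate `quad(x) = Q₁(x₁) + Q₂(x₂) + x₁ᵀ C x₂` (the internal value: ARBITRARY one-sided parts `Q₁, Q₂`, cross block `C`),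
* the WALK coordinate `W(x) = Σ_{x₁ i} ww₁ i + Σ_{x₂ i} ww₂ i ∈ ℤ/3` with all weights `ww ≠ 0` (the weights `1 + [l < g₀] ∈ {1,2}`).

★ `quad_saturation`: if (d1) every non-zero combination `Σ_j γ_j L_j` has at least `w ≤ |ι₁|+|ι₂|` non-zero coordinates (both sides together),
(d2′) at most `E` ordered pairs `(x₁,x₁′)` have `wt((x₁−x₁′)ᵀC) < w₂`, and the smallness condition
`3·p^{K+1}·(cos(π/(3p))^w + √(E + 4^{|ι₁|}cos(π/p)^{w₂}) / 2^{|ι₁|}) < 1` holds, then `(lin, quad, W)` is ONTO `(ℤ/p)^K × ℤ/p × ℤ/3`.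
The three character classes: `s = 0, γ ≠ 0` (product of two weighted cube sums, weight `≥ w` by (d1)); `s = 0, γ = 0, m ≠ 0` (every coordinate
twisted); `s ≠ 0` (the bilinear lemma with cross block `sC`, one-sided phases absorbed in `F₁, F₂`; `wt((x₁−x₁′)ᵀ sC) = wt((x₁−x₁′)ᵀ C)` as `s` is a unit).
What this leaves for (c0): the inputs — (d1) from (PS)+K1 freeness of the surviving forms, (d2′) a dispersing bipartition or else the (P7)/(K3)+(K4)
structure — and the (P6)/(P9) case assembly against `LabelSurjective.loss_of_columnSaturation`.
-/

open Finset Complex ZMod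
open Literature.Computability.MetaComplexity.TwoModuli
open Summit.QuantumAdvantage.QuantumAdvantage.Theorems.BilinearCubeSum

namespace Summit.QuantumAdvantage.QuantumAdvantage.Theorems.QuadSaturation

variable {p : ℕ} [Fact p.Prime] {ι₁ ι₂ : Type*} [Fintype ι₁] [Fintype ι₂] [DecidableEq ι₁] [DecidableEq ι₂] {K : ℕ}

/-- the `ℤ/3`-valued weighted count of a cube point -/
def cubeW {ι : Type*} [Fintype ι] (ww : ι → ZMod 3) (x : ι → Bool) : ZMod 3 := ∑ i, if x i then ww i else 0

/-- the `K` linear coordinates of the labelled map on the product cube -/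
def linPart (L₁ : Fin K → ι₁ → ZMod p) (L₂ : Fin K → ι₂ → ZMod p) (x : (ι₁ → Bool) × (ι₂ → Bool)) : Fin K → ZMod p :=
  fun j => cubePhase (L₁ j) x.1 + cubePhase (L₂ j) x.2

/-- the quadratic coordinate: arbitrary one-sided parts plus the cross block -/
def quadPart (Q₁ : (ι₁ → Bool) → ZMod p) (Q₂ : (ι₂ → Bool) → ZMod p) (C : ι₁ → ι₂ → ZMod p)
    (x : (ι₁ → Bool) × (ι₂ → Bool)) : ZMod p :=
  Q₁ x.1 + Q₂ x.2 + cubePhase (rowForm C x.1) x.2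

/-- the walk coordinate -/
def walkPart (ww₁ : ι₁ → ZMod 3) (ww₂ : ι₂ → ZMod 3) (x : (ι₁ → Bool) × (ι₂ → Bool)) : ZMod 3 :=
  cubeW ww₁ x.1 + cubeW ww₂ x.2

/-- the full coordinate map into `(ℤ/p)^{K+1}`: the linear coordinates, then the quadratic one -/
def fullMap (L₁ : Fin K → ι₁ → ZMod p) (L₂ : Fin K → ι₂ → ZMod p) (Q₁ : (ι₁ → Bool) → ZMod p) (Q₂ : (ι₂ → Bool) → ZMod p)
    (C : ι₁ → ι₂ → ZMod p) (x : (ι₁ → Bool) × (ι₂ → Bool)) : Fin (K + 1) → ZMod p :=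
  Fin.snoc (linPart L₁ L₂ x) (quadPart Q₁ Q₂ C x)

/-- the combined form of a dual vector: `Σ_j γ_j lin_j(x) = cubePhase β₁ x₁ + cubePhase β₂ x₂`, `β_s i = Σ_j γ_j L_s j i` -/
theorem sum_mul_linPart (γ : Fin K → ZMod p) (L₁ : Fin K → ι₁ → ZMod p) (L₂ : Fin K → ι₂ → ZMod p)
    (x : (ι₁ → Bool) × (ι₂ → Bool)) :
    ∑ j, γ j * linPart L₁ L₂ x j
      = cubePhase (fun i => ∑ j, γ j * L₁ j i) x.1 + cubePhase (fun i => ∑ j, γ j * L₂ j i) x.2 := by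
  unfold linPart cubePhase
  simp_rw [mul_add, sum_add_distrib]
  rw [sum_mul_linForms_eq γ L₁ x.1, sum_mul_linForms_eq γ L₂ x.2]

/-- scaling the cross block scales the bilinear phase -/
theorem cubePhase_rowForm_smul (s : ZMod p) (C : ι₁ → ι₂ → ZMod p) (x₁ : ι₁ → Bool) (x₂ : ι₂ → Bool) :
    cubePhase (rowForm (fun i j => s * C i j) x₁) x₂ = s * cubePhase (rowForm C x₁) x₂ := by
  unfold cubePhase rowForm
  rw [mul_sum]
  refine sum_congr rfl fun j _ => ?_
  split_ifs
  · rw [mul_sum]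
    refine sum_congr rfl fun i _ => ?_
    split_ifs <;> simp
  · simp

/-- scaling the cross block by a unit does not change the weights of its row combinations -/
theorem rowForm_smul_support {s : ZMod p} (hs : s ≠ 0) (C : ι₁ → ι₂ → ZMod p) (x₁ x₁' : ι₁ → Bool) :
    (univ.filter fun j => (rowForm (fun i j => s * C i j) x₁ - rowForm (fun i j => s * C i j) x₁') j ≠ 0)
      = (univ.filter fun j => (rowForm C x₁ - rowForm C x₁') j ≠ 0) := by
  have hrow : ∀ x : ι₁ → Bool, ∀ j, rowForm (fun i j => s * C i j) x j = s * rowForm C x j := by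
    intro x j
    unfold rowForm
    rw [mul_sum]
    refine sum_congr rfl fun i _ => ?_
    split_ifs <;> simp
  ext j
  simp only [mem_filter, mem_univ, true_and, Pi.sub_apply, hrow, ← mul_sub]
  rw [mul_ne_zero_iff]
  exact ⟨fun h => h.2, fun h => ⟨hs, h⟩⟩

/-- a weighted cube sum on the product cube is the product of the two one-sided weighted cube sums -/
theorem sum_prod_cube_eq [NeZero p] (β₁ : ι₁ → ZMod p) (β₂ : ι₂ → ZMod p) (m₁ : ι₁ → ZMod 3) (m₂ : ι₂ → ZMod 3) :
    ∑ x : (ι₁ → Bool) × (ι₂ → Bool),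
        (stdAddChar (cubePhase β₁ x.1 + cubePhase β₂ x.2) : ℂ) * stdAddChar (cubeW m₁ x.1 + cubeW m₂ x.2)
      = (∑ x₁ : ι₁ → Bool, (stdAddChar (∑ i, if x₁ i then β₁ i else 0) : ℂ) * stdAddChar (∑ i, if x₁ i then m₁ i else 0))
        * (∑ x₂ : ι₂ → Bool, (stdAddChar (∑ i, if x₂ i then β₂ i else 0) : ℂ) * stdAddChar (∑ i, if x₂ i then m₂ i else 0)) := by
  rw [Fintype.sum_prod_type, sum_mul_sum]
  refine sum_congr rfl fun x₁ _ => sum_congr rfl fun x₂ _ => ?_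
  unfold cubePhase cubeW
  rw [AddChar.map_add_eq_mul, AddChar.map_add_eq_mul]
  push_cast
  ring

/-- **QUADRATIC SATURATION ((P4) of the (c0) road, assembled).**  See the module docstring. -/
theorem quad_saturation (hp3 : p.Coprime 3) (L₁ : Fin K → ι₁ → ZMod p) (L₂ : Fin K → ι₂ → ZMod p)
    (Q₁ : (ι₁ → Bool) → ZMod p) (Q₂ : (ι₂ → Bool) → ZMod p) (C : ι₁ → ι₂ → ZMod p)
    (ww₁ : ι₁ → ZMod 3) (ww₂ : ι₂ → ZMod 3) (hww₁ : ∀ i, ww₁ i ≠ 0) (hww₂ : ∀ i, ww₂ i ≠ 0)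
    (w : ℕ) (hw : w ≤ Fintype.card ι₁ + Fintype.card ι₂)
    (hfree : ∀ γ : Fin K → ZMod p, γ ≠ 0 →
      w ≤ (univ.filter fun i => (∑ j, γ j * L₁ j i) ≠ 0).card + (univ.filter fun i => (∑ j, γ j * L₂ j i) ≠ 0).card)
    (w₂ E : ℕ)
    (hdisp : (univ.filter fun xx : (ι₁ → Bool) × (ι₁ → Bool) =>
      (univ.filter fun j => (rowForm C xx.1 - rowForm C xx.2) j ≠ 0).card < w₂).card ≤ E)
    (hsmall : 3 * (p : ℝ) ^ (K + 1) *
      (Real.cos (Real.pi / (p * 3)) ^ w + Real.sqrt (E + 4 ^ Fintype.card ι₁ * Real.cos (Real.pi / p) ^ w₂) / 2 ^ Fintype.card ι₁) < 1)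
    (v : Fin K → ZMod p) (t : ZMod p) (a : ZMod 3) :
    ∃ x : (ι₁ → Bool) × (ι₂ → Bool), linPart L₁ L₂ x = v ∧ quadPart Q₁ Q₂ C x = t ∧ walkPart ww₁ ww₂ x = a := by
  classical
  haveI : NeZero p := ⟨(Fact.out : p.Prime).ne_zero⟩
  have hp2 : 2 ≤ p := (Fact.out : p.Prime).two_le
  have hp1 : (1 : ℝ) ≤ p := by exact_mod_cast (Fact.out : p.Prime).one_lt.le
  -- reduce to the non-empty-fibre criterion for `(fullMap, walkPart)`
  suffices h : ∃ x : (ι₁ → Bool) × (ι₂ → Bool), fullMap L₁ L₂ Q₁ Q₂ C x = Fin.snoc v t ∧ walkPart ww₁ ww₂ x = a by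
    obtain ⟨x, hx, hW⟩ := h
    refine ⟨x, ?_, ?_, hW⟩
    · funext j
      have := congrFun hx j.castSucc
      simpa [fullMap] using this
    · have := congrFun hx (Fin.last K)
      simpa [fullMap] using this
  refine SaturationCriterion.fibre_nonempty_of_charSum_lt (fullMap L₁ L₂ Q₁ Q₂ C) (walkPart ww₁ ww₂) ?_ (Fin.snoc v t) a
  -- abbreviations
  set c₃ : ℝ := Real.cos (Real.pi / (p * 3)) with hc₃
  set c₁ : ℝ := Real.cos (Real.pi / p) with hc₁
  set ρ : ℝ := Real.sqrt (E + 4 ^ Fintype.card ι₁ * c₁ ^ w₂) / 2 ^ Fintype.card ι₁ with hρ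
  have hc₃0 : 0 ≤ c₃ := by
    rw [hc₃]
    apply Real.cos_nonneg_of_neg_pi_div_two_le_of_le
    · have : 0 ≤ Real.pi / (p * 3) := by positivity
      linarith [Real.pi_pos]
    · exact div_le_div_of_nonneg_left Real.pi_pos.le (by norm_num) (by nlinarith)
  have hc₃1 : c₃ ≤ 1 := Real.cos_le_one _
  have hρ0 : 0 ≤ ρ := by rw [hρ]; positivity
  have hcard : (Fintype.card ((ι₁ → Bool) × (ι₂ → Bool)) : ℝ) = 2 ^ Fintype.card ι₁ * 2 ^ Fintype.card ι₂ := by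
    rw [Fintype.card_prod, Fintype.card_fun, Fintype.card_fun, Fintype.card_bool]
    push_cast
    ring
  -- the dual pairing with `fullMap` splits into the linear combination and `s · quad`
  have hpair : ∀ (γ : Fin (K + 1) → ZMod p) (x : (ι₁ → Bool) × (ι₂ → Bool)),
      ∑ j, γ j * fullMap L₁ L₂ Q₁ Q₂ C x j
        = (cubePhase (fun i => ∑ j : Fin K, γ j.castSucc * L₁ j i) x.1 + cubePhase (fun i => ∑ j : Fin K, γ j.castSucc * L₂ j i) x.2)
          + γ (Fin.last K) * quadPart Q₁ Q₂ C x := by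
    intro γ x
    rw [Fin.sum_univ_castSucc, ← sum_mul_linPart]
    unfold fullMap
    simp
  -- PER-CLASS BOUND
  have hS : ∀ γm : (Fin (K + 1) → ZMod p) × ZMod 3, γm ≠ 0 →
      ‖SaturationCriterion.charSum (fullMap L₁ L₂ Q₁ Q₂ C) (walkPart ww₁ ww₂) γm.1 γm.2‖
        ≤ 2 ^ Fintype.card ι₁ * 2 ^ Fintype.card ι₂ * (c₃ ^ w + ρ) := by
    rintro ⟨γ, m⟩ hγm
    set γ' : Fin K → ZMod p := fun j => γ j.castSucc with hγ'
    set s : ZMod p := γ (Fin.last K) with hs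
    set β₁ : ι₁ → ZMod p := fun i => ∑ j : Fin K, γ' j * L₁ j i with hβ₁
    set β₂ : ι₂ → ZMod p := fun i => ∑ j : Fin K, γ' j * L₂ j i with hβ₂
    have h22 : (0 : ℝ) ≤ 2 ^ Fintype.card ι₁ * 2 ^ Fintype.card ι₂ := by positivity
    by_cases hs0 : s = 0
    · -- `s = 0`: a weighted linear cube sum on the product cube
      have hrw : SaturationCriterion.charSum (fullMap L₁ L₂ Q₁ Q₂ C) (walkPart ww₁ ww₂) γ m
          = (∑ x₁ : ι₁ → Bool, (stdAddChar (∑ i, if x₁ i then β₁ i else 0) : ℂ) * stdAddChar (∑ i, if x₁ i then m * ww₁ i else 0))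
            * (∑ x₂ : ι₂ → Bool, (stdAddChar (∑ i, if x₂ i then β₂ i else 0) : ℂ) * stdAddChar (∑ i, if x₂ i then m * ww₂ i else 0)) := by
        rw [← sum_prod_cube_eq]
        unfold SaturationCriterion.charSum
        refine sum_congr rfl fun x _ => ?_
        rw [hpair γ x, ← hs, hs0, zero_mul, add_zero]
        congr 2
        unfold walkPart cubeW
        rw [mul_add, mul_sum, mul_sum]
        congr 1 <;> exact sum_congr rfl fun i _ => by split_ifs <;> simp
      rw [hrw, norm_mul]
      by_cases hγ'0 : γ' = 0
      · -- `γ = 0`, so `m ≠ 0`: every coordinate twisted on both sides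
        have hm : m ≠ 0 := by
          intro hm
          apply hγm
          ext j
          · simp only [Prod.fst_zero, Pi.zero_apply]
            refine Fin.lastCases ?_ (fun j' => ?_) j
            · rw [← hs, hs0]
            · have := congrFun hγ'0 j'
              simpa [hγ'] using this
          · simpa using hm
        have hb₁ : β₁ = 0 := by funext i; simp [hβ₁, hγ'0]
        have hb₂ : β₂ = 0 := by funext i; simp [hβ₂, hγ'0]
        have e₁ := SaturationCriterion.norm_cubeSum_weighted_le_of_forall hp3 β₁ (fun i => m * ww₁ i)
          fun i => Or.inr (mul_ne_zero hm (hww₁ i))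
        have e₂ := SaturationCriterion.norm_cubeSum_weighted_le_of_forall hp3 β₂ (fun i => m * ww₂ i)
          fun i => Or.inr (mul_ne_zero hm (hww₂ i))
        calc ‖∑ x₁ : ι₁ → Bool, (stdAddChar (∑ i, if x₁ i then β₁ i else 0) : ℂ) * stdAddChar (∑ i, if x₁ i then m * ww₁ i else 0)‖
              * ‖∑ x₂ : ι₂ → Bool, (stdAddChar (∑ i, if x₂ i then β₂ i else 0) : ℂ) * stdAddChar (∑ i, if x₂ i then m * ww₂ i else 0)‖
            ≤ (2 * c₃) ^ Fintype.card ι₁ * (2 * c₃) ^ Fintype.card ι₂ :=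
              mul_le_mul e₁ e₂ (norm_nonneg _) (pow_nonneg (by positivity) _)
          _ = 2 ^ Fintype.card ι₁ * 2 ^ Fintype.card ι₂ * c₃ ^ (Fintype.card ι₁ + Fintype.card ι₂) := by
              rw [mul_pow, mul_pow, pow_add]; ring
          _ ≤ 2 ^ Fintype.card ι₁ * 2 ^ Fintype.card ι₂ * c₃ ^ w :=
              mul_le_mul_of_nonneg_left (pow_le_pow_of_le_one hc₃0 hc₃1 hw) h22
          _ ≤ 2 ^ Fintype.card ι₁ * 2 ^ Fintype.card ι₂ * (c₃ ^ w + ρ) := by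
              apply mul_le_mul_of_nonneg_left _ h22
              linarith
      · -- `γ' ≠ 0`: the combined form has `≥ w` non-zero coordinates over both sides
        have e₁ := SaturationCriterion.norm_cubeSum_weighted_le hp3 β₁ (fun i => m * ww₁ i)
        have e₂ := SaturationCriterion.norm_cubeSum_weighted_le hp3 β₂ (fun i => m * ww₂ i)
        have hwt : w ≤ (univ.filter fun i => β₁ i ≠ 0).card + (univ.filter fun i => β₂ i ≠ 0).card := hfree γ' hγ'0
        calc ‖∑ x₁ : ι₁ → Bool, (stdAddChar (∑ i, if x₁ i then β₁ i else 0) : ℂ) * stdAddChar (∑ i, if x₁ i then m * ww₁ i else 0)‖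
              * ‖∑ x₂ : ι₂ → Bool, (stdAddChar (∑ i, if x₂ i then β₂ i else 0) : ℂ) * stdAddChar (∑ i, if x₂ i then m * ww₂ i else 0)‖
            ≤ (2 ^ Fintype.card ι₁ * c₃ ^ (univ.filter fun i => β₁ i ≠ 0).card)
                * (2 ^ Fintype.card ι₂ * c₃ ^ (univ.filter fun i => β₂ i ≠ 0).card) :=
              mul_le_mul e₁ e₂ (norm_nonneg _) (by positivity)
          _ = 2 ^ Fintype.card ι₁ * 2 ^ Fintype.card ι₂
                * c₃ ^ ((univ.filter fun i => β₁ i ≠ 0).card + (univ.filter fun i => β₂ i ≠ 0).card) := by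
              rw [pow_add]; ring
          _ ≤ 2 ^ Fintype.card ι₁ * 2 ^ Fintype.card ι₂ * c₃ ^ w :=
              mul_le_mul_of_nonneg_left (pow_le_pow_of_le_one hc₃0 hc₃1 hwt) h22
          _ ≤ 2 ^ Fintype.card ι₁ * 2 ^ Fintype.card ι₂ * (c₃ ^ w + ρ) := by
              apply mul_le_mul_of_nonneg_left _ h22
              linarith
    · -- `s ≠ 0`: the bilinear lemma with cross block `sC`
      set F₁ : (ι₁ → Bool) → ℂ := fun x₁ =>
        (stdAddChar (cubePhase β₁ x₁ + s * Q₁ x₁) : ℂ) * stdAddChar (m * cubeW ww₁ x₁) with hF₁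
      set F₂ : (ι₂ → Bool) → ℂ := fun x₂ =>
        (stdAddChar (cubePhase β₂ x₂ + s * Q₂ x₂) : ℂ) * stdAddChar (m * cubeW ww₂ x₂) with hF₂
      have hF₁n : ∀ x, ‖F₁ x‖ ≤ 1 := fun x => by
        rw [hF₁, norm_mul, Literature.Analysis.Fourier.norm_stdAddChar, Literature.Analysis.Fourier.norm_stdAddChar, one_mul]
      have hF₂n : ∀ x, ‖F₂ x‖ ≤ 1 := fun x => by
        rw [hF₂, norm_mul, Literature.Analysis.Fourier.norm_stdAddChar, Literature.Analysis.Fourier.norm_stdAddChar, one_mul]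
      have hrw : SaturationCriterion.charSum (fullMap L₁ L₂ Q₁ Q₂ C) (walkPart ww₁ ww₂) γ m
          = ∑ x₁ : ι₁ → Bool, ∑ x₂ : ι₂ → Bool,
              F₁ x₁ * F₂ x₂ * (stdAddChar (cubePhase (rowForm (fun i j => s * C i j) x₁) x₂) : ℂ) := by
        unfold SaturationCriterion.charSum
        rw [Fintype.sum_prod_type]
        refine sum_congr rfl fun x₁ _ => sum_congr rfl fun x₂ _ => ?_
        rw [hpair γ (x₁, x₂), cubePhase_rowForm_smul, hF₁, hF₂]
        unfold quadPart walkPart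
        simp only [← hs]
        rw [show cubePhase β₁ x₁ + cubePhase β₂ x₂ + s * (Q₁ x₁ + Q₂ x₂ + cubePhase (rowForm C x₁) x₂)
            = (cubePhase β₁ x₁ + s * Q₁ x₁) + (cubePhase β₂ x₂ + s * Q₂ x₂) + s * cubePhase (rowForm C x₁) x₂ by ring, mul_add]
        simp only [AddChar.map_add_eq_mul]
        ring
      have hdisp' : (univ.filter fun xx : (ι₁ → Bool) × (ι₁ → Bool) =>
          (univ.filter fun j => (rowForm (fun i j => s * C i j) xx.1 - rowForm (fun i j => s * C i j) xx.2) j ≠ 0).card < w₂).card ≤ E := by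
        simp_rw [rowForm_smul_support hs0 C]
        exact hdisp
      have hsq := norm_sq_bilinear_le_of_disperse (fun i j => s * C i j) F₁ F₂ hF₁n hF₂n hp2 w₂ E hdisp'
      rw [hrw]
      -- take square roots
      have hZ0 : (0 : ℝ) ≤ E + 4 ^ Fintype.card ι₁ * c₁ ^ w₂ := by
        have : ‖∑ x₁ : ι₁ → Bool, ∑ x₂ : ι₂ → Bool,
            F₁ x₁ * F₂ x₂ * (stdAddChar (cubePhase (rowForm (fun i j => s * C i j) x₁) x₂) : ℂ)‖ ^ 2
              ≤ 4 ^ Fintype.card ι₂ * (E + 4 ^ Fintype.card ι₁ * c₁ ^ w₂) := hsq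
        by_contra hneg
        push Not at hneg
        have h4 : (0 : ℝ) < 4 ^ Fintype.card ι₂ := by positivity
        nlinarith [sq_nonneg ‖∑ x₁ : ι₁ → Bool, ∑ x₂ : ι₂ → Bool,
            F₁ x₁ * F₂ x₂ * (stdAddChar (cubePhase (rowForm (fun i j => s * C i j) x₁) x₂) : ℂ)‖]
      have hbound : ‖∑ x₁ : ι₁ → Bool, ∑ x₂ : ι₂ → Bool,
          F₁ x₁ * F₂ x₂ * (stdAddChar (cubePhase (rowForm (fun i j => s * C i j) x₁) x₂) : ℂ)‖
            ≤ 2 ^ Fintype.card ι₂ * Real.sqrt (E + 4 ^ Fintype.card ι₁ * c₁ ^ w₂) := by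
        have h2 : (0 : ℝ) ≤ 2 ^ Fintype.card ι₂ := by positivity
        rw [← Real.sqrt_sq (norm_nonneg _), ← Real.sqrt_sq h2, ← Real.sqrt_mul (pow_nonneg h2 2)]
        apply Real.sqrt_le_sqrt
        calc _ ≤ (4 : ℝ) ^ Fintype.card ι₂ * (E + 4 ^ Fintype.card ι₁ * c₁ ^ w₂) := hsq
          _ = (2 ^ Fintype.card ι₂) ^ 2 * (E + 4 ^ Fintype.card ι₁ * c₁ ^ w₂) := by
              rw [← pow_mul, mul_comm (Fintype.card ι₂) 2, pow_mul]; norm_num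
      calc _ ≤ 2 ^ Fintype.card ι₂ * Real.sqrt (E + 4 ^ Fintype.card ι₁ * c₁ ^ w₂) := hbound
        _ = 2 ^ Fintype.card ι₁ * 2 ^ Fintype.card ι₂ * ρ := by
            rw [hρ]
            field_simp
        _ ≤ 2 ^ Fintype.card ι₁ * 2 ^ Fintype.card ι₂ * (c₃ ^ w + ρ) := by
            apply mul_le_mul_of_nonneg_left _ h22
            linarith [pow_nonneg hc₃0 w]
  -- SUM OVER THE NON-TRIVIAL CLASSES
  have hcardG : (((univ : Finset ((Fin (K + 1) → ZMod p) × ZMod 3)).erase 0).card : ℝ) ≤ 3 * (p : ℝ) ^ (K + 1) := by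
    have h : ((univ : Finset ((Fin (K + 1) → ZMod p) × ZMod 3)).erase 0).card ≤ p ^ (K + 1) * 3 := by
      calc ((univ : Finset ((Fin (K + 1) → ZMod p) × ZMod 3)).erase 0).card
          ≤ (univ : Finset ((Fin (K + 1) → ZMod p) × ZMod 3)).card := card_erase_le
        _ = p ^ (K + 1) * 3 := by
            rw [card_univ, Fintype.card_prod, Fintype.card_fun, ZMod.card, ZMod.card, Fintype.card_fin]
    calc (((univ : Finset ((Fin (K + 1) → ZMod p) × ZMod 3)).erase 0).card : ℝ) ≤ ((p ^ (K + 1) * 3 : ℕ) : ℝ) := by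
          exact_mod_cast h
      _ = 3 * (p : ℝ) ^ (K + 1) := by push_cast; ring
  have hpos : 0 ≤ c₃ ^ w + ρ := by positivity
  calc ∑ γm ∈ (univ : Finset ((Fin (K + 1) → ZMod p) × ZMod 3)).erase 0,
        ‖SaturationCriterion.charSum (fullMap L₁ L₂ Q₁ Q₂ C) (walkPart ww₁ ww₂) γm.1 γm.2‖
      ≤ ∑ γm ∈ (univ : Finset ((Fin (K + 1) → ZMod p) × ZMod 3)).erase 0,
          2 ^ Fintype.card ι₁ * 2 ^ Fintype.card ι₂ * (c₃ ^ w + ρ) := sum_le_sum fun γm hγm => hS γm (ne_of_mem_erase hγm)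
    _ = ((univ : Finset ((Fin (K + 1) → ZMod p) × ZMod 3)).erase 0).card * (2 ^ Fintype.card ι₁ * 2 ^ Fintype.card ι₂ * (c₃ ^ w + ρ)) := by
        rw [sum_const, nsmul_eq_mul]
    _ ≤ 3 * (p : ℝ) ^ (K + 1) * (2 ^ Fintype.card ι₁ * 2 ^ Fintype.card ι₂ * (c₃ ^ w + ρ)) :=
        mul_le_mul_of_nonneg_right hcardG (by positivity)
    _ = 2 ^ Fintype.card ι₁ * 2 ^ Fintype.card ι₂ * (3 * (p : ℝ) ^ (K + 1) * (c₃ ^ w + ρ)) := by ring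
    _ < 2 ^ Fintype.card ι₁ * 2 ^ Fintype.card ι₂ * 1 := by
        apply mul_lt_mul_of_pos_left _ (by positivity)
        rw [hc₃, hρ, hc₁]
        exact hsmall
    _ = Fintype.card ((ι₁ → Bool) × (ι₂ → Bool)) := by rw [mul_one, hcard]

end Summit.QuantumAdvantage.QuantumAdvantage.Theorems.QuadSaturation
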